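import Literature.AlgebraicGeometry.Pohlmann1968.HodgeClassesCMAlgebra
import Literature.AlgebraicGeometry.Pohlmann1968.NondegenerateCMTypeDivisorGenerated
import Literature.NumberTheory.ComplexMultiplication.CMTypeElementaryTwoGroupOddWeights
import Literature.NumberTheory.ComplexMultiplication.AbelianCMFamilyRankCharacters
import Mathlib.Data.Finset.Sum
import HarnessLib

/-!
# Galois-balanced weights on `Hom(k,ℂ) ⊔ Hom(K,ℂ)` for `k` imaginary quadratic inside a MULTIQUADRATIC CM field `K`:
# no balanced weight contains exactly one embedding of `k` (the combinatorial heart of `CurveTimesMultiquadraticCMHodge`)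

COR-CM (cell `pub-hodgecm2`, binder seat `b25` gen 35, count-neutral claim PRODSPAN-POWERS (F15, part 1/2)); NEW as
stated, hence under `Summits/`.  Theorems only; no definition, no named fact, no `sorry`.

For `K` a CM field, normal over `ℚ` with COMMUTATIVE Galois group of EXPONENT `2` and `[K:ℚ] ≥ 4`, `k` imaginary
quadratic with `j : k → K`, `Φ` a NONDEGENERATE CM type of `K` and `Φ_k` a CM type of `k`:

* §1 instance-free (`Set.ncard`) bookkeeping for counts over the two blocks of a weight
  `S ⊆ (Fin 1 × Hom(k,ℂ)) ⊔ (Fin 1 × Hom(K,ℂ))` (the index sets of the one-slot families of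
  `Pohlmann1968.hodgeClassesProductSpan_biproduct_of_blocksSplit`);
* §2 the quadratic block: `Hom(k,ℂ) = {x, x̄}`, and `#{t | τ t ∈ Φ_k} = 1` for every `τ ∈ Aut(ℂ)` (`ncard_univ_sep_eq_one`);
* §3 **`not_balanced_of_card_toLeft_eq_one`** — a weight with exactly ONE embedding of `k` is never Galois balanced.
  Indexing `Hom(K,ℂ)` by `G = Gal(K/ℚ)` (`Pohlmann1968.embOf φ₀`, `φ₀` extending the `k`-embedding `x` along `j`;
  `Aut(ℂ)` acts through `G` by translation, `Pohlmann1968.smul_embOf_of_comp`), the balance at the automorphisms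
  `τ_g` (`τ_g ∘ φ₀ = φ₀ ∘ g`) reads `#{h ∈ T | hg ∈ Ψ} + [g c ∈ H] = p` with `Ψ = {g | σ_g ∈ Φ}` (a CM type on `G` seen
  by every odd character: `Pohlmann1968.isNondegenerate_iff_forall_oddCharacters`), `H = Gal(K/j(k))`, `T` the `K`-part
  of the weight (`|T| = 2p − 1` odd) — excluded by the parity obstruction
  `ComplexMultiplication.not_forall_card_filter_add_indicator_eq` for elementary abelian `2`-groups.

## References
* [MoonenZarhin1999LowDim] B. Moonen, Yu. Zarhin, Math. Ann. 315 (1999) 711–733, §3 (3.1), Thm. (0.2).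
* [Kubota1965] T. Kubota, Trans. AMS 118 (1965), §4 Lemma 2.
* [Shimura1998] G. Shimura, *Abelian Varieties with Complex Multiplication and Modular Functions*, §8.1, §18.2.

Provenance: Literature home (family `hodge`, namespace `Literature.AlgebraicGeometry.ComplexMultiplication.Multiquadratic`) of the Summits-side `CorCM/CurveTimesMultiquadraticCMWeights` (cell `pub-hodgecm2`, COR-CM; all its imports are `Literature/` and Mathlib), which `Literature/` may not import; theorems only, no named fact, no definition. Nothing here bears on `HC_CM`. Lane `lit-hodgefound` (Layer A3: CM types, their Kubota ranks and Galois combinatorics), seat p20.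
-/

noncomputable section

open NumberField

namespace Literature.AlgebraicGeometry.ComplexMultiplication.Multiquadratic

open Literature.AlgebraicGeometry.Motives (CMType)
open Literature.AlgebraicGeometry.Pohlmann1968
open Literature.NumberTheory.ComplexMultiplication

open scoped Classical

/-! ### §1 Bookkeeping: counting over the two blocks (instance-free `ncard` forms) -/

section Bookkeeping

/-- `#{z ∈ S | Q z} + #{z ∈ S | ¬Q z} = |S|`. [cite: Shimura1998, §18.2 Lemma] -/
theorem ncard_add_ncard_not {γ : Type*} (S : Finset γ) (Q : γ → Prop) :
    {z | z ∈ S ∧ Q z}.ncard + {z | z ∈ S ∧ ¬ Q z}.ncard = S.card := by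
  have hdisj : Disjoint {z | z ∈ S ∧ Q z} {z | z ∈ S ∧ ¬ Q z} :=
    Set.disjoint_left.mpr fun z hz hz' => hz'.2 hz.2
  have hunion : {z | z ∈ S ∧ Q z} ∪ {z | z ∈ S ∧ ¬ Q z} = (S : Set γ) := by
    ext z
    simp only [Set.mem_union, Set.mem_setOf_eq, Finset.mem_coe]
    tauto
  rw [← Set.ncard_union_eq hdisj (S.finite_toSet.subset fun z hz => hz.1) (S.finite_toSet.subset fun z hz => hz.1),
    hunion, Set.ncard_coe_finset]

/-- `#{z ∈ S | Q z}` as the cardinality of a filter. [cite: Shimura1998, §18.2 Lemma] -/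
theorem ncard_sep_eq_card_filter {γ : Type*} (S : Finset γ) (Q : γ → Prop) :
    {z | z ∈ S ∧ Q z}.ncard = (S.filter Q).card := by
  rw [← Set.ncard_coe_finset, Finset.coe_filter]

/-- A count over a finite set of `α ⊕ β` splits over the two blocks. [cite: Shimura1998, §18.2 Lemma] -/
theorem ncard_sep_eq_add {α β : Type*} (S : Finset (α ⊕ β)) (Q : α ⊕ β → Prop) :
    {z | z ∈ S ∧ Q z}.ncard = {a | a ∈ S.toLeft ∧ Q (Sum.inl a)}.ncard + {b | b ∈ S.toRight ∧ Q (Sum.inr b)}.ncard := by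
  rw [ncard_sep_eq_card_filter, ncard_sep_eq_card_filter, ncard_sep_eq_card_filter, Finset.card_filter,
    Finset.card_filter, Finset.card_filter]
  conv_lhs => rw [← Finset.toLeft_disjSum_toRight (u := S)]
  rw [Finset.sum_disjSum]

/-- `|S| = |S ∩ block₁| + |S ∩ block₂|`. [cite: Shimura1998, §18.2 Lemma] -/
theorem card_eq_add {α β : Type*} (S : Finset (α ⊕ β)) : S.card = S.toLeft.card + S.toRight.card :=
  (Finset.card_toLeft_add_card_toRight (u := S)).symm

/-- `#{t ∈ {a} | P t} = [P a]`. [cite: Shimura1998, §18.2 Lemma] -/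
theorem ncard_sep_singleton {γ : Type*} (a : γ) (P : γ → Prop) :
    {t | t ∈ ({a} : Finset γ) ∧ P t}.ncard = if P a then 1 else 0 := by
  by_cases h : P a
  · rw [if_pos h]
    have : {t | t ∈ ({a} : Finset γ) ∧ P t} = {a} := by
      ext t
      simp only [Set.mem_setOf_eq, Finset.mem_singleton, Set.mem_singleton_iff]
      exact ⟨fun ht => ht.1, fun ht => ⟨ht, ht ▸ h⟩⟩
    rw [this, Set.ncard_singleton]
  · rw [if_neg h]
    have : {t | t ∈ ({a} : Finset γ) ∧ P t} = ∅ := by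
      ext t
      simp only [Set.mem_setOf_eq, Finset.mem_singleton, Set.mem_empty_iff_false, iff_false, not_and]
      rintro rfl; exact h
    rw [this, Set.ncard_empty]

/-- `#{t ∈ ∅ | P t} = 0`. [cite: Shimura1998, §18.2 Lemma] -/
theorem ncard_sep_empty {γ : Type*} (P : γ → Prop) : {t | t ∈ (∅ : Finset γ) ∧ P t}.ncard = 0 := by
  have : {t | t ∈ (∅ : Finset γ) ∧ P t} = ∅ := by
    ext t; simp
  rw [this, Set.ncard_empty]

end Bookkeeping

/-! ### §2 The imaginary quadratic block -/

section Quadratic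

variable {k : Type} [Field k] [NumberField k]

omit [NumberField k] in
/-- `x̄ ∈ Φ ↔ x ∉ Φ` for a CM type. [cite: Shimura1998, §18.2 Lemma] -/
theorem conjugate_mem_iff (Φ₀ : CMType k) (y : k →+* ℂ) :
    ComplexEmbedding.conjugate y ∈ Φ₀.1 ↔ y ∉ Φ₀.1 := by
  have h := Φ₀.2 (ComplexEmbedding.conjugate y)
  rwa [show ComplexEmbedding.conjugate (ComplexEmbedding.conjugate y) = y from
    ComplexEmbedding.involutive_conjugate k y] at h

/-- The two embeddings of the imaginary quadratic field: every `t : k → ℂ` is `x` or `x̄`. [cite: Shimura1998, §18.2 Lemma] -/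
theorem eq_or_eq_conjugate (Φ₀ : CMType k) (hk : Module.finrank ℚ k = 2) (x t : k →+* ℂ) :
    t = x ∨ t = ComplexEmbedding.conjugate x := by
  have hne : ComplexEmbedding.conjugate x ≠ x := conjugate_ne_self Φ₀ x
  have hcard : Fintype.card (k →+* ℂ) = 2 := by rw [Embeddings.card, hk]
  have huniv : (Finset.univ : Finset (k →+* ℂ)) = {x, ComplexEmbedding.conjugate x} :=
    (Finset.eq_univ_of_card _ (by rw [Finset.card_pair hne.symm, hcard])).symm
  have ht := Finset.mem_univ t
  rw [huniv, Finset.mem_insert, Finset.mem_singleton] at ht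
  exact ht

variable [IsCMField k]

/-- Exactly one of `τx`, `τx̄` lies in a CM type of `k`: `#{t ∈ Hom(k,ℂ) | τ t ∈ Φ_k} = 1` — the full block
`Hom(k, ℂ)` (read on the one-slot family over `Fin 1`) is balanced. [cite: Shimura1998, §18.2 Lemma] -/
theorem ncard_univ_sep_eq_one (Φk : CMType k) (hk : Module.finrank ℚ k = 2) (τ : ℂ ≃+* ℂ) :
    {t | t ∈ (Finset.univ : Finset ((_ : Fin 1) × (k →+* ℂ))) ∧ (τ : ℂ →+* ℂ).comp t.2 ∈ Φk.1}.ncard = 1 := by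
  obtain ⟨x⟩ := (inferInstance : Nonempty (k →+* ℂ))
  have hne : ComplexEmbedding.conjugate x ≠ x := conjugate_ne_self Φk x
  -- `τ x̄ = conj (τ x)` (complex conjugation commutes with `Aut(ℂ)` on a CM field)
  have hconj : (τ : ℂ →+* ℂ).comp (ComplexEmbedding.conjugate x) = ComplexEmbedding.conjugate ((τ : ℂ →+* ℂ).comp x) := by
    have h := (isCMTypeWith_conj Φk).comm τ x
    rw [conj_smul_eq_conjugate, conj_smul_eq_conjugate] at h
    exact h
  -- the unique member `t₀` with `τ t₀ ∈ Φ_k`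
  have hone : ∀ t : k →+* ℂ, (τ : ℂ →+* ℂ).comp t ∈ Φk.1 ↔
      t = (if (τ : ℂ →+* ℂ).comp x ∈ Φk.1 then x else ComplexEmbedding.conjugate x) := by
    intro t
    by_cases hx : (τ : ℂ →+* ℂ).comp x ∈ Φk.1
    · rw [if_pos hx]
      rcases eq_or_eq_conjugate Φk hk x t with rfl | rfl
      · exact ⟨fun _ => rfl, fun _ => hx⟩
      · rw [hconj]
        exact ⟨fun h => absurd hx ((Φk.2 _).1 hx |> fun h' => absurd h h'), fun h => absurd h hne⟩
    · rw [if_neg hx]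
      rcases eq_or_eq_conjugate Φk hk x t with rfl | rfl
      · exact ⟨fun h => absurd h hx, fun h => absurd h hne.symm⟩
      · rw [hconj]
        exact ⟨fun _ => rfl, fun _ => (conjugate_mem_iff Φk _).2 hx⟩
  set t₀ : k →+* ℂ := if (τ : ℂ →+* ℂ).comp x ∈ Φk.1 then x else ComplexEmbedding.conjugate x with ht₀
  have hset : {t | t ∈ (Finset.univ : Finset ((_ : Fin 1) × (k →+* ℂ))) ∧ (τ : ℂ →+* ℂ).comp t.2 ∈ Φk.1} =
      {⟨0, t₀⟩} := by
    ext t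
    obtain ⟨i, t⟩ := t
    obtain rfl : i = 0 := Subsingleton.elim _ _
    simp only [Set.mem_setOf_eq, Finset.mem_univ, true_and, Set.mem_singleton_iff, hone t]
    constructor
    · rintro rfl; rfl
    · intro h; exact eq_of_heq (Sigma.mk.inj h).2
  rw [hset, Set.ncard_singleton]

end Quadratic

/-! ### §3 No balanced weight has exactly one embedding of `k` -/

section Main

variable {k : Type} [Field k] [NumberField k] [IsCMField k]
  {K : Type} [Field K] [NumberField K] [IsCMField K] [Normal ℚ K]
  {Φk : CMType k} {Φ : CMType K}

omit [IsCMField k] [IsCMField K] in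
/-- **The heart: no Galois-balanced weight on `Hom(k,ℂ) ⊔ Hom(K,ℂ)` contains exactly ONE embedding of `k`** (for `K`
multiquadratic over `ℚ` containing `k`, `Φ` nondegenerate).  With `x` the `k`-embedding, `φ₀ : K → ℂ` extending `x`
along `j`, `σ_g = φ₀ ∘ g⁻¹` the indexing of `Hom(K,ℂ)` by `G = Gal(K/ℚ)`, `Ψ = {g | σ_g ∈ Φ}`, `H = Gal(K/j(k))` and `T`
the `K`-part of the weight read on `G`: the balance at `τ_g` (`τ_g ∘ φ₀ = φ₀ ∘ g`) says
`#{h ∈ T | hg ∈ Ψ} + [g c ∈ H] = p`, `|T| = 2p − 1` odd — excluded by the parity obstruction.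
[cite: Kubota1965, §4 Lemma 2] [cite: MoonenZarhin1999LowDim, §3 (3.1)] -/
theorem not_balanced_of_card_toLeft_eq_one (hk : Module.finrank ℚ k = 2) (j : k →+* K)
    (hcomm : ∀ g h : K ≃ₐ[ℚ] K, g * h = h * g) (hexp : ∀ g : K ≃ₐ[ℚ] K, g * g = 1) (h4 : 4 ≤ Module.finrank ℚ K)
    (hnd : IsNondegenerate Φ)
    (S : Finset (((_ : Fin 1) × (k →+* ℂ)) ⊕ ((_ : Fin 1) × (K →+* ℂ)))) (p : ℕ) (hS1 : S.toLeft.card = 1)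
    (hS : ∀ τ : ℂ ≃+* ℂ,
      {z | z ∈ S ∧ Sum.elim (fun t : (_ : Fin 1) × (k →+* ℂ) => (τ : ℂ →+* ℂ).comp t.2 ∈ Φk.1)
        (fun y : (_ : Fin 1) × (K →+* ℂ) => (τ : ℂ →+* ℂ).comp y.2 ∈ Φ.1) z}.ncard = p ∧
      {z | z ∈ S ∧ ¬ Sum.elim (fun t : (_ : Fin 1) × (k →+* ℂ) => (τ : ℂ →+* ℂ).comp t.2 ∈ Φk.1)
        (fun y : (_ : Fin 1) × (K →+* ℂ) => (τ : ℂ →+* ℂ).comp y.2 ∈ Φ.1) z}.ncard = p) : False := by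
  letI : CommGroup (K ≃ₐ[ℚ] K) := { (inferInstance : Group (K ≃ₐ[ℚ] K)) with mul_comm := hcomm }
  haveI : IsGalois ℚ K := ⟨⟩
  obtain ⟨a, ha⟩ := Finset.card_eq_one.1 hS1
  set x : k →+* ℂ := a.2 with hxdef
  -- a base embedding `φ₀` of `K` extending `x` along `j`
  obtain ⟨ι₀⟩ := (inferInstance : Nonempty (K →+* ℂ))
  obtain ⟨g₀, hg₀⟩ := exists_eq_comp_algEquiv_comp (K := fun _ : Fin 1 => k) ι₀ (fun _ => j) 0 x
  set φ₀ : K →+* ℂ := ι₀.comp (g₀ : K →+* K) with hφ₀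
  have hφ₀j : φ₀.comp j = x := by rw [hg₀]
  -- complex conjugation `ρ ∈ Gal(K/ℚ)` for `φ₀`
  obtain ⟨ρ, hρ'⟩ := exists_algEquiv_comp_eq φ₀ (ComplexEmbedding.conjugate φ₀)
  have hρ : ∀ y, φ₀ (ρ y) = starRingEnd ℂ (φ₀ y) := fun y => by rw [hρ' y]; rfl
  -- the type read on the Galois group and its nondegeneracy
  have hΨ := isCMTypeWith_gal hcomm Φ φ₀ ρ hρ
  have hset : ({g : K ≃ₐ[ℚ] K | embOf φ₀ g ∈ Φ.1} : Set (K ≃ₐ[ℚ] K)) =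
      ↑(Finset.univ.filter fun g : K ≃ₐ[ℚ] K => embOf φ₀ g ∈ Φ.1) := by
    ext g; simp
  rw [hset] at hΨ
  have hndχ := (isNondegenerate_iff_forall_oddCharacters hcomm Φ φ₀ ρ hρ).1 hnd
  -- `H = Gal(K/j(k))`
  let H : Subgroup (K ≃ₐ[ℚ] K) :=
    { carrier := {g | ∀ y, g (j y) = j y}
      one_mem' := fun y => rfl
      mul_mem' := fun {g} {h} hg hh y => by
        show (g * h) (j y) = j y
        rw [AlgEquiv.mul_apply, hh, hg]
      inv_mem' := fun {g} hg => by
        have : g⁻¹ = g := inv_eq_of_mul_eq_one_right (hexp g)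
        rw [this]; exact hg }
  have hmemH : ∀ g : K ≃ₐ[ℚ] K, g ∈ H ↔ ∀ y, g (j y) = j y := fun g => Iff.rfl
  have hxne : ComplexEmbedding.conjugate x ≠ x := conjugate_ne_self Φk x
  have hρρ : ρ * ρ = 1 := hexp ρ
  -- dichotomy: `g ∈ H` (then `φ₀ g j = x`) or `ρ g ∈ H` (then `φ₀ g j = x̄`)
  have hcomp_apply : ∀ (g : K ≃ₐ[ℚ] K) (y : k), (φ₀.comp ((g : K →+* K).comp j)) y = φ₀ (g (j y)) := fun g y => by
    simp only [RingHom.coe_comp, Function.comp_apply, RingHom.coe_coe]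
  have hxy : ∀ y : k, x y = φ₀ (j y) := fun y => by rw [← hφ₀j]; rfl
  have hdich : ∀ g : K ≃ₐ[ℚ] K, (g ∈ H ∧ φ₀.comp ((g : K →+* K).comp j) = x) ∨
      (ρ * g ∈ H ∧ φ₀.comp ((g : K →+* K).comp j) = ComplexEmbedding.conjugate x) := by
    intro g
    rcases eq_or_eq_conjugate Φk hk x (φ₀.comp ((g : K →+* K).comp j)) with h | h
    · refine Or.inl ⟨(hmemH g).2 fun y => φ₀.injective ?_, h⟩
      rw [← hcomp_apply, h, hxy]
    · refine Or.inr ⟨(hmemH _).2 fun y => ?_, h⟩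
      have h1 : φ₀ (g (j y)) = φ₀ (ρ (j y)) := by
        rw [← hcomp_apply, h, ComplexEmbedding.conjugate_coe_eq, hxy, hρ]
      rw [AlgEquiv.mul_apply, φ₀.injective h1, ← AlgEquiv.mul_apply, hρρ, AlgEquiv.one_apply]
  have hρH : ρ ∉ H := by
    intro h
    apply hxne
    refine RingHom.ext fun y => ?_
    rw [ComplexEmbedding.conjugate_coe_eq, hxy, ← hρ, (hmemH ρ).1 h y]
  have hnotboth : ∀ g : K ≃ₐ[ℚ] K, g ∈ H → ρ * g ∉ H := by
    intro g hg hρg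
    apply hρH
    have : ρ = ρ * g * g := by rw [mul_assoc, hexp g, mul_one]
    rw [this]
    exact H.mul_mem hρg hg
  -- a non-trivial element of `H` (`|Gal(K/ℚ)| = [K:ℚ] ≥ 4`)
  have hcardG : 4 ≤ Fintype.card (K ≃ₐ[ℚ] K) := by
    rw [← Nat.card_eq_fintype_card, IsGalois.card_aut_eq_finrank]; exact h4
  obtain ⟨h₀, hh₀H, hh₀⟩ : ∃ h₀ : K ≃ₐ[ℚ] K, h₀ ∈ H ∧ h₀ ≠ 1 := by
    -- some `g ∉ {1, ρ}`
    have hlt : (({1, ρ} : Finset (K ≃ₐ[ℚ] K))).card < (Finset.univ : Finset (K ≃ₐ[ℚ] K)).card := by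
      have h2 : (({1, ρ} : Finset (K ≃ₐ[ℚ] K))).card ≤ 2 := Finset.card_le_two
      rw [Finset.card_univ]
      omega
    obtain ⟨g, -, hg⟩ := Finset.exists_mem_notMem_of_card_lt_card hlt
    rw [Finset.mem_insert, Finset.mem_singleton, not_or] at hg
    rcases hdich g with ⟨hgH, -⟩ | ⟨hρgH, -⟩
    · exact ⟨g, hgH, hg.1⟩
    · refine ⟨ρ * g, hρgH, fun h => hg.2 ?_⟩
      have : g = ρ * (ρ * g) := by rw [← mul_assoc, hρρ, one_mul]
      rw [this, h, mul_one]
  -- the `K`-block read on `G`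
  set S₂ := S.toRight with hS₂
  let T : Finset (K ≃ₐ[ℚ] K) :=
    Finset.univ.filter fun h => (⟨0, embOf φ₀ h⟩ : (_ : Fin 1) × (K →+* ℂ)) ∈ S₂
  have hTcount : ∀ (P : (K →+* ℂ) → Prop),
      {y | y ∈ S₂ ∧ P y.2}.ncard = (T.filter fun h => P (embOf φ₀ h)).card := by
    intro P
    rw [ncard_sep_eq_card_filter]
    let e : (K ≃ₐ[ℚ] K) ≃ (K →+* ℂ) := Equiv.ofBijective (embOf φ₀) (embOf_bijective φ₀)
    have he : ∀ g, e g = embOf φ₀ g := fun g => rfl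
    have hlift : ∀ y : (_ : Fin 1) × (K →+* ℂ), (⟨0, embOf φ₀ (e.symm y.2)⟩ : (_ : Fin 1) × (K →+* ℂ)) = y :=
      fun y => by rw [← he, e.apply_symm_apply]; exact Sigma.ext (Subsingleton.elim _ _) HEq.rfl
    refine Finset.card_nbij' (fun y => e.symm y.2) (fun h => ⟨0, embOf φ₀ h⟩) ?_ ?_ ?_ ?_
    · intro y hy
      rw [Finset.mem_coe, Finset.mem_filter] at hy
      rw [Finset.mem_coe, Finset.mem_filter, Finset.mem_filter, hlift, ← he, e.apply_symm_apply]
      exact ⟨⟨Finset.mem_univ _, hy.1⟩, hy.2⟩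
    · intro h hh
      rw [Finset.mem_coe, Finset.mem_filter, Finset.mem_filter] at hh
      rw [Finset.mem_coe, Finset.mem_filter]
      exact ⟨hh.1.2, hh.2⟩
    · intro y _
      exact hlift y
    · intro h _
      show e.symm (embOf φ₀ h) = h
      rw [← he]; exact e.symm_apply_apply h
  -- sizes: `|S₂| = |T| = 2p − 1`
  have hS₂T : S₂.card = T.card := by
    have h := hTcount fun _ => True
    rw [Finset.filter_true] at h
    rw [← h, ← Set.ncard_coe_finset]
    exact congrArg Set.ncard (Set.ext fun y => by simp)
  have hTodd : Odd T.card := by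
    have h11 := (hS 1).1
    have h12 := (hS 1).2
    have htot := ncard_add_ncard_not S
      (Sum.elim (fun t : (_ : Fin 1) × (k →+* ℂ) => ((1 : ℂ ≃+* ℂ) : ℂ →+* ℂ).comp t.2 ∈ Φk.1)
        (fun y : (_ : Fin 1) × (K →+* ℂ) => ((1 : ℂ ≃+* ℂ) : ℂ →+* ℂ).comp y.2 ∈ Φ.1))
    have hsz : S.card = S.toLeft.card + S.toRight.card := card_eq_add S
    rw [hS1, ← hS₂, hS₂T] at hsz
    exact ⟨p - 1, by omega⟩
  -- the constant of the obstruction: `c = 1` if `x ∈ Φ_k`, `c = ρ` otherwise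
  let c : K ≃ₐ[ℚ] K := if x ∈ Φk.1 then 1 else ρ
  refine not_forall_card_filter_add_indicator_eq hexp hΨ hndχ H hh₀H hh₀ T hTodd c p fun g => ?_
  -- the automorphism `τ_g` with `τ_g ∘ φ₀ = φ₀ ∘ g`
  obtain ⟨τ, hτ⟩ := exists_ringEquiv_comp_eq_algEquiv φ₀ g
  have h1 := (hS τ).1
  rw [ncard_sep_eq_add S, ha] at h1
  simp only [Sum.elim_inl, Sum.elim_inr] at h1
  -- the `K`-block count
  have hK : {y | y ∈ S₂ ∧ (τ : ℂ →+* ℂ).comp y.2 ∈ Φ.1}.ncard =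
      (T.filter fun h => h * g ∈ (Finset.univ.filter fun g : K ≃ₐ[ℚ] K => embOf φ₀ g ∈ Φ.1)).card := by
    rw [hTcount fun s => (τ : ℂ →+* ℂ).comp s ∈ Φ.1]
    congr 1
    refine Finset.filter_congr fun h _ => ?_
    have hsm : (τ : ℂ →+* ℂ).comp (embOf φ₀ h) = embOf φ₀ (h * g) := by
      have := smul_embOf_of_comp φ₀ hτ h
      rw [show g⁻¹ = g from inv_eq_of_mul_eq_one_right (hexp g)] at this
      exact this
    rw [hsm]
    simp
  -- the `k`-block count
  have hconjmem : ComplexEmbedding.conjugate x ∈ Φk.1 ↔ x ∉ Φk.1 := conjugate_mem_iff Φk x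
  have hτx : (τ : ℂ →+* ℂ).comp x = φ₀.comp ((g : K →+* K).comp j) := by
    refine RingHom.ext fun y => ?_
    rw [hcomp_apply, ← hτ (j y), ← hxy]
    rfl
  have hgρ : g * ρ = ρ * g := hcomm g ρ
  have hk1 : {t | t ∈ ({a} : Finset ((_ : Fin 1) × (k →+* ℂ))) ∧ (τ : ℂ →+* ℂ).comp t.2 ∈ Φk.1}.ncard =
      if g * c ∈ H then 1 else 0 := by
    rw [ncard_sep_singleton, ← hxdef, hτx]
    rcases hdich g with ⟨hgH, hgx⟩ | ⟨hρgH, hgx⟩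
    · rw [hgx]
      by_cases hx : x ∈ Φk.1
      · have hc : g * c ∈ H := by simp only [c, if_pos hx, mul_one]; exact hgH
        rw [if_pos hx, if_pos hc]
      · have hc : g * c ∉ H := by simp only [c, if_neg hx, hgρ]; exact hnotboth g hgH
        rw [if_neg hx, if_neg hc]
    · rw [hgx]
      have hgH : g ∉ H := fun hgH => hnotboth g hgH hρgH
      by_cases hx : x ∈ Φk.1
      · have hc : g * c ∉ H := by simp only [c, if_pos hx, mul_one]; exact hgH
        rw [if_neg (fun h => hconjmem.1 h hx), if_neg hc]
      · have hc : g * c ∈ H := by simp only [c, if_neg hx, hgρ]; exact hρgH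
        rw [if_pos (hconjmem.2 hx), if_pos hc]
  rw [hk1, hK] at h1
  omega

end Main

end Literature.AlgebraicGeometry.ComplexMultiplication.Multiquadratic

end
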